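import Summits.Ventures.YMGap.RobustBall.TorusOneLink
import Literature.MathematicalPhysics.QuantumLattice.LatticeGaugeDLRGibbsProofs
import HarnessLib

/-!
# Venture YMGap, track ROBUST-BALL — the VAN HOVE JOIN, step 2: (a) a probability measure satisfying the DLR
# equations of a Feller specification on bounded continuous CYLINDER observables is a Gibbs measure;
# (b) two torus perturbations whose totals differ by a volume-independent function have the same kernel

HONEST FRAMING. WHAT THIS IS: a venture file (cell `pub-ymgap`, track Y2 ROBUST-BALL, seat ds-3), two
generic measure-theoretic lemmas for the identification of the track's two currencies (DLR states on `ℤ^d`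
vs infinite-volume limit states of perturbed torus states), no estimate of their own.
(a) `isGibbsMeasure_of_cylinderDLR`: on the compact metrisable configuration space `LGConfig d G` of a compact
second-countable group, if `γ` is a specification with the Feller property (kernel averages of bounded
continuous functions are continuous in the boundary condition) and `μ` is a probability measure with
`∫ F dμ = ∫ (∫ F dγ_Λ(·|η)) dμ(η)` for every finite `Λ` and every bounded continuous CYLINDER observable `F`,
then `μ ∈ 𝒢(γ)` — Steps 2–4 of the tree's `mem_ymGibbsMeasures_of_mem_infiniteVolumeLimitPoints_holds`
(Georgii 2011, Thm. 4.17) VERBATIM with `ymSpecification` replaced by `γ`: cylinder approximation by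
dominated convergence, separation of finite Borel measures by bounded continuous functions, `μ γ_Λ = μ`.
(b) `perturbedTorusSpec_eq_of_total_sub`: if the totals of two torus perturbations `W₁, W₂` differ, on the
fibre `{ζ V_{Λ'ᶜ}}` of the volume `Λ'` above `V`, by the constant `W₁.total V − W₂.total V`, then
`γ^{W₁,β}_{Λ'}(·|V) = γ^{W₂,β}_{Λ'}(·|V)` (Mathlib `tilted_congr`, `tilted_tilted`, `tilted_const`: a tilt by a
function constant on the support is no tilt). WHAT THIS IS NOT: no lattice estimate; nothing about the
continuum or the Clay Millennium problem.

References: H.-O. Georgii (2011), Def. 1.23, Rem. 1.24, Thm. 4.17; S. Friedli, Y. Velenik (2017), Lemma 6.7,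
Thm. 6.26; the tree's `LatticeGaugeDLRGibbsProofs.lean` (followed line by line) and `TorusOneLink.lean`
(`perturbedTorusSpec`, `isSpecification_perturbedTorusSpec`).
-/

noncomputable section

open MeasureTheory Filter Topology Function
open Literature.Probability.LatticeModels
open Literature.MathematicalPhysics.QuantumLattice hiding torusNorm
open Literature.MathematicalPhysics.QuantumFieldTheory hiding ZdEdge
open Literature.MathematicalPhysics.QuantumFieldTheory.Balaban1983to89.StrongCouplingTorusWindow
  (wilsonPlaqWeight)

namespace Summit.Ventures.YMGap.RobustBall

/-! ### (a) Cylinder DLR equations for a Feller specification give a Gibbs measure -/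

section CylinderDLR

variable {d : ℕ} {G : Type*} [Group G] [TopologicalSpace G] [IsTopologicalGroup G]
  [MeasurableSpace G] [BorelSpace G] [SecondCountableTopology G]

/-- **Cylinder DLR ⇒ Gibbs.** Let `γ` be a specification on `LGConfig d G` (`G` a compact second-countable
group) with the FELLER property — `η ↦ ∫ F dγ_Λ(·|η)` is continuous for bounded continuous `F` — and let `μ` be a
probability measure such that `∫ F dμ = ∫ (∫ F dγ_Λ(·|η)) dμ(η)` for every finite volume `Λ` and every bounded
continuous CYLINDER observable `F` (`IsCylinder F S₀`, `S₀` finite). Then `μ` is a Gibbs measure of `γ`.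
Proof = Steps 2–4 of the tree's `mem_ymGibbsMeasures_of_mem_infiniteVolumeLimitPoints_holds` (Georgii 2011,
Thm. 4.17): the identity extends to all bounded continuous `F` by dominated convergence along the cylinder
approximations `F((T n).piecewise U 1)`; bounded continuous functions separate finite Borel measures on the
compact metrisable configuration space, so `μ.bind γ_Λ = μ`, which is the DLR equation. [folklore] -/
theorem isGibbsMeasure_of_cylinderDLR {γ : Specification (ZdEdge d) G} (hγ : IsSpecification γ)
    (hFeller : ∀ (Λ : Finset (ZdEdge d)) (F : LGConfig d G → ℝ), Continuous F → ∀ C : ℝ,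
      (∀ U, |F U| ≤ C) → Continuous fun η => ∫ U, F U ∂(γ Λ η))
    {μ : Measure (LGConfig d G)} [IsProbabilityMeasure μ]
    (hcyl : ∀ (Λ : Finset (ZdEdge d)) (F : LGConfig d G → ℝ) (S₀ : Finset (ZdEdge d)), IsCylinder F S₀ →
      Continuous F → ∀ C : ℝ, (∀ U, |F U| ≤ C) → ∫ U, F U ∂μ = ∫ η, (∫ U, F U ∂(γ Λ η)) ∂μ) :
    IsGibbsMeasure γ μ := by
  classical
  refine ⟨inferInstance, fun Λ A hA => ?_⟩
  haveI hγprob : ∀ η, IsProbabilityMeasure (γ Λ η) := hγ.isProbability Λ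
  -- kernel averages of a function bounded by `C` are bounded by `C`
  have hbound : ∀ {F : LGConfig d G → ℝ} {C : ℝ}, (∀ U, |F U| ≤ C) → ∀ η, |∫ U, F U ∂(γ Λ η)| ≤ C :=
    fun {F C} hC η => by
      have h := norm_integral_le_of_norm_le_const (μ := γ Λ η) (f := F) (C := C)
        (ae_of_all _ fun U => by simpa [Real.norm_eq_abs] using hC U)
      simpa [Real.norm_eq_abs] using h
  -- Step 2: extension to all bounded continuous observables by cylinder approximation
  have core : ∀ F : LGConfig d G → ℝ, Continuous F → ∀ C : ℝ, (∀ U, |F U| ≤ C) →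
      ∫ U, F U ∂μ = ∫ η, (∫ U, F U ∂(γ Λ η)) ∂μ := by
    intro F hFc C hC
    obtain ⟨T, hT⟩ := exists_piecewise_tendsto (E := ZdEdge d) (1 : LGConfig d G)
    have hpc : ∀ n, Continuous fun U : LGConfig d G => (T n).piecewise U 1 := fun n =>
      continuous_pi fun e => by
        by_cases he : e ∈ T n
        · simp only [Finset.piecewise_eq_of_mem _ _ _ he]; exact continuous_apply e
        · simp only [Finset.piecewise_eq_of_notMem _ _ _ he]; exact continuous_const
    have hcylT : ∀ n, IsCylinder (fun U => F ((T n).piecewise U 1)) (T n) := fun n U U' h =>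
      congrArg F ((T n).piecewise_congr (fun e he => h e (Finset.mem_coe.2 he)) fun _ _ => rfl)
    have hlim_μ : Tendsto (fun n => ∫ U, F ((T n).piecewise U 1) ∂μ) atTop (𝓝 (∫ U, F U ∂μ)) :=
      tendsto_integral_of_dominated_convergence (fun _ => C)
        (fun n => (hFc.comp (hpc n)).aestronglyMeasurable) (integrable_const C)
        (fun n => ae_of_all _ fun U => by simpa [Real.norm_eq_abs] using hC _)
        (ae_of_all _ fun U => (hFc.tendsto U).comp (hT U))
    have hlim_γ : ∀ η, Tendsto (fun n => ∫ U, F ((T n).piecewise U 1) ∂(γ Λ η))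
        atTop (𝓝 (∫ U, F U ∂(γ Λ η))) := fun η =>
      tendsto_integral_of_dominated_convergence (fun _ => C)
        (fun n => (hFc.comp (hpc n)).aestronglyMeasurable) (integrable_const C)
        (fun n => ae_of_all _ fun U => by simpa [Real.norm_eq_abs] using hC _)
        (ae_of_all _ fun U => (hFc.tendsto U).comp (hT U))
    have hlim_μγ : Tendsto (fun n => ∫ η, (∫ U, F ((T n).piecewise U 1) ∂(γ Λ η)) ∂μ) atTop
        (𝓝 (∫ η, (∫ U, F U ∂(γ Λ η)) ∂μ)) :=
      tendsto_integral_of_dominated_convergence (fun _ => C)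
        (fun n => (hFeller Λ _ (hFc.comp (hpc n)) C (fun U => hC _)).aestronglyMeasurable)
        (integrable_const C)
        (fun n => ae_of_all _ fun η => by
          simpa [Real.norm_eq_abs] using hbound (F := fun U => F ((T n).piecewise U 1)) (fun U => hC _) η)
        (ae_of_all _ hlim_γ)
    have heq : (fun n => ∫ U, F ((T n).piecewise U 1) ∂μ) = fun n =>
        ∫ η, (∫ U, F ((T n).piecewise U 1) ∂(γ Λ η)) ∂μ :=
      funext fun n => hcyl Λ _ (T n) (hcylT n) (hFc.comp (hpc n)) C fun U => hC _
    rw [heq] at hlim_μ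
    exact tendsto_nhds_unique hlim_μ hlim_μγ
  -- Step 3: `μ = μ γ_Λ` as measures, tested on bounded continuous functions
  have hκ : Measurable (γ Λ) := hγ.measurable_fun Λ
  have hμeq : μ = μ.bind (γ Λ) := by
    refine ext_of_forall_lintegral_eq_of_IsFiniteMeasure fun f => ?_
    have hfm : Measurable fun x => (f x : ENNReal) :=
      measurable_coe_nnreal_ennreal.comp f.continuous.measurable
    rw [Measure.lintegral_bind hκ.aemeasurable hfm.aemeasurable]
    have hfc : Continuous fun x => (f x : ℝ) := NNReal.continuous_coe.comp f.continuous
    have hfb : ∀ x, |(f x : ℝ)| ≤ nndist f 0 := fun x => by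
      rw [abs_of_nonneg (f x).coe_nonneg]
      exact_mod_cast BoundedContinuousFunction.NNReal.upper_bound f x
    have hint : ∀ (m : Measure (LGConfig d G)) [IsFiniteMeasure m],
        ∫⁻ x, (f x : ENNReal) ∂m = ENNReal.ofReal (∫ x, (f x : ℝ) ∂m) := by
      intro m _
      rw [← BoundedContinuousFunction.toReal_lintegral_coe_eq_integral,
        ENNReal.ofReal_toReal (BoundedContinuousFunction.lintegral_lt_top_of_nnreal m f).ne]
    have hpt : (fun η => ∫⁻ x, (f x : ENNReal) ∂(γ Λ η)) = fun η =>
        ENNReal.ofReal (∫ x, (f x : ℝ) ∂(γ Λ η)) :=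
      funext fun η => hint _
    rw [hint μ, hpt, ← ofReal_integral_eq_lintegral_ofReal]
    · rw [core _ hfc _ hfb]
    · exact integrable_of_bound (hFeller Λ _ hfc _ hfb).aestronglyMeasurable (hbound hfb)
    · exact ae_of_all _ fun η => integral_nonneg fun x => (f x).coe_nonneg
  -- Step 4: the DLR equation for `A`
  calc ∫⁻ η, γ Λ η A ∂μ = (μ.bind (γ Λ)) A := (Measure.bind_apply hA hκ.aemeasurable).symm
    _ = μ A := by rw [← hμeq]

end CylinderDLR

/-! ### (b) Torus perturbations with volume-independent difference have the same kernel -/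

section Torus

variable {d L N : ℕ} [NeZero L]

/-- A tilt by a function plus a constant is the tilt by the function, for a probability measure and an
exponentially integrable function. [folklore] -/
theorem tilted_add_const_eq {α : Type*} [MeasurableSpace α] (μ : Measure α) [IsProbabilityMeasure μ]
    {f : α → ℝ} (hf : Integrable (fun x => Real.exp (f x)) μ) (c : ℝ) :
    μ.tilted (fun x => f x + c) = μ.tilted f := by
  haveI : IsProbabilityMeasure (μ.tilted f) := isProbabilityMeasure_tilted hf
  rw [show (fun x => f x + c) = f + fun _ => c from rfl, ← tilted_tilted hf, tilted_const]

/-- **Two torus perturbations whose totals differ by a `Λ'`-independent function have the same `Λ'`-kernel.**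
If `W₁.total (ζ V_{Λ'ᶜ}) − W₂.total (ζ V_{Λ'ᶜ}) = W₁.total V − W₂.total V` for every `ζ ∈ SU(N)^{Λ'}` (the
difference of the totals does not feel the links of `Λ'`), then
`perturbedTorusSpec W₁ β Λ' V = perturbedTorusSpec W₂ β Λ' V`. [folklore] -/
theorem perturbedTorusSpec_eq_of_total_sub (W₁ W₂ : Perturbation d L N) (β : ℝ) (Λ' : Finset (Edge d L))
    (V : GaugeConfig d L (SUN N))
    (h : ∀ ζ : ↥Λ' → SUN N,
      W₁.total (glueWith Λ' ζ V) - W₂.total (glueWith Λ' ζ V) = W₁.total V - W₂.total V) :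
    perturbedTorusSpec W₁ β Λ' V = perturbedTorusSpec W₂ β Λ' V := by
  set c : ℝ := W₁.total V - W₂.total V with hc
  set ν : Measure (GaugeConfig d L (SUN N)) :=
    (Measure.pi fun _ : ↥Λ' => haarProbability (SUN N)).map (glueWith Λ' · V) with hν
  haveI : IsProbabilityMeasure ν := Measure.isProbabilityMeasure_map (measurable_glueWith Λ' V).aemeasurable
  set φ₁ : GaugeConfig d L (SUN N) → ℝ := fun U => torusLogWeight (wilsonPlaqWeight N β) U - W₁.total U
  set φ₂ : GaugeConfig d L (SUN N) → ℝ := fun U => torusLogWeight (wilsonPlaqWeight N β) U - W₂.total U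
  have hφ₁m : Measurable φ₁ := measurable_perturbedTorusEnergy W₁ β
  have hφ₂m : Measurable φ₂ := measurable_perturbedTorusEnergy W₂ β
  -- on the fibre, `φ₁ = φ₂ - c`
  have hae : φ₁ =ᵐ[ν] fun U => φ₂ U + (-c) := by
    have hset : MeasurableSet {U : GaugeConfig d L (SUN N) | φ₁ U = φ₂ U + (-c)} :=
      measurableSet_eq_fun hφ₁m (hφ₂m.add_const _)
    rw [Filter.EventuallyEq, hν, ae_map_iff (measurable_glueWith Λ' V).aemeasurable hset]
    refine ae_of_all _ fun ζ => ?_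
    have hζ := h ζ
    show φ₁ (glueWith Λ' ζ V) = φ₂ (glueWith Λ' ζ V) + -c
    simp only [φ₁, φ₂, hc] at hζ ⊢
    linarith
  -- exponential integrability of `φ₂` on the fibre (bounded energy)
  obtain ⟨C, hC⟩ := exists_abs_perturbedTorusEnergy_le W₂ β
  have hint : Integrable (fun U => Real.exp (φ₂ U)) ν :=
    integrable_of_bound (Real.measurable_exp.comp hφ₂m).aestronglyMeasurable (C := Real.exp C) fun U => by
      rw [abs_of_pos (Real.exp_pos _)]
      exact Real.exp_le_exp.2 (le_of_abs_le (hC U))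
  have key : ν.tilted φ₁ = ν.tilted φ₂ := by rw [tilted_congr hae, tilted_add_const_eq ν hint]
  unfold perturbedTorusSpec
  exact key

end Torus

end Summit.Ventures.YMGap.RobustBall

end
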